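/-
Copyright (c) 2026 the pub-hodgecm-mathlib formalisation cell (harness21).  Prover seat hodgecm-mathlib-LH4-p15 (g0), req620 Track A «(D-RAM) FOUR-FRAME» squad
((β₂) road (R-36) «PURE-CELL LEDGER»; (AX-sh-C) HEAD = the lane-C (RamM) twin of ★ p862589 `F0P3cDyRamAxisLetterOneClass`, dealt by LH4-p12 (g8) 22:39:53Z; socket =
LH4-p12's `…AxisColumnZeroOfLettersRamM` over ★ p862391), 2026-09-04.
-/
import Summits.HodgeConjecture.HodgeConjecture.Theorems.F0P3cDyRamAxisLetterOneClass         -- ★ p862589 (this seat): `isOrd_tokens_of_shell`, `valueSet_axis_eq_lineValueSet` (lane-free); brings ★ p862003, ★ №6 `mcOfRecord`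
import Summits.HodgeConjecture.HodgeConjecture.Theorems.F0P3cDyRamAxisLetterEstimatesRamM    -- ★ (this seat, (AX-sh-C) 2∕3): `exists_fixed_unit_lineValueSet_axis_eq_smul_xPlus_ramM`
import HarnessLib

/-!
# Crux `H413`, line LH4 «(D-RAM) FOUR-FRAME» — STAGE-1b, row (2), the (β₂) road (R-36), row (AX-sh-C) HEAD: «THE `hdich` OF (AX-0) ON THE WHOLE AXIS COLUMN, LANE C (RamM)» —
# ★ p862003's `hdich` binder, byte shape, at `(ℓ, mc, a) = (d % 2, mcOfRecord d, 0)`, for the ramified line model (`|jE a| = |a|²`, `α − ρα = ϖM − ρϖM`), under the two DEEP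
# letters `|lam − 1| ≤ |jE ϖ^N|`, `|u₀₀ − 1| ≤ |ϖ^N|` (`N ≥ m* + dρ∕2 + 1`) that the (L-Σ-3C) V-shrink supplies

Cell `hodgecm-mathlib` (D-0151), FLOOR 0, crux item H413 = `stmt-HodgeConjecture-24833`, route of record `HCCMUnconditional`; squad F0∕P3c∕LH4; lane
`--supports stmt-HodgeConjecture-24833 --as helper` (count-neutral; pays NO tier-0 row).  THEOREMS ONLY (no `def`, no instance, no notation, no `sorry`, default heartbeats);
★-only imports; states NO law; (β₂) stays a HYPOTHESIS.  DATUM-FREE over ★ p862003's block-frame binders plus the lane-C letters of `beta2CellsCFrame.letter.v1` (931c87fe):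
`Θ h = h`, `Θ lam·lam = 1`, `|jE a| = |a|²`, `IsRamifiedQuadraticDatum ρ ϖM dρ tρ`, `α − ρα = ϖM − ρϖM`, `dρ = 2r` (★ letter `2·dK = dρ + 2g`).

WHY (LH4-p12 (g8) 22:39:53Z «YOURS — the lane-C twin»; memo `AXIS-HDICH-LANEC-SCOPING.v1` 2c5dc5b5 §3: lane C closes with one deeper letter, free near `1` by ★ `exists_nhds_one_block_congr`).
★ p862589 gives `hdich` for lanes A∕B with no extra letter; in lane C the cross-term estimate is short by `dρ∕2` digits (memo §2), and ★ (AX-sh-C) 2∕3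
`exists_fixed_unit_lineValueSet_axis_eq_smul_xPlus_ramM` recovers it from the deep letters.  THIS FILE is the dictionary to ★ p862003's lattice letters, exactly as ★ p862589 §3
(its §1 `isOrd_tokens_of_shell` and §2 `valueSet_axis_eq_lineValueSet` are lane-free and reused BY NAME): HEAD `exists_fixed_unit_valueSet_axis_eq_smul_xPlus_ramM` — for every
level `j` and every `g₂` with `φ(latt g₂) ∈ levelSet ρ Θ α (jE ϖ) h j 0` whose axis vertex lies on the shell `(d % 2, mcOfRecord d)` of `Γ − 1`: `∃ e`, `σe = e`, `|e| = 1`,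
`VS_{m*}(latt ι(g₂, 1)) = valueSetMod σ ϖ m* (e • X₊)`.  The single arithmetic side condition `mstarOfRecord d + r + 1 ≤ N` feeds the nine inequalities of ★ 2∕3 at `m = m*`,
`2k = m_c`, `k′ = m′ = N`, `2n′ = 2⌊(N + d)∕2⌋` (`omega`).
HONEST LABEL.  Count-neutral lattice ∕ order algebra; nothing printed is asserted; no census law is stated; (AX-0)'s sum and (β₂) stay exactly as ★ p862391 ∕ the typed letters leave
them; `HC_CM` is proved only modulo the 7 printed citations (2 remaining named inputs: hLiu418 = `stmt-HodgeConjecture-24832`, h413 = `stmt-HodgeConjecture-24833`) until rung 0 closes.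
## References
* [Rogawski1990] J. D. Rogawski, *Automorphic Representations of Unitary Groups in Three Variables*, Ann. of Math. Stud. 123 (1990): §4.9 Prop. 4.9.1 (b) p. 55.
* [Jacobowitz1962] R. Jacobowitz, *Hermitian forms over local fields*, Amer. J. Math. 84 (1962): §4 (unimodular hermitian lines; duals and gluing).
* [Kottwitz1986BaseChangeUnits] R. E. Kottwitz, *Base change for unit elements of Hecke algebras*, Compositio Math. 60 (1986): §1 pp. 240–241, §3.
* [Serre1979] J.-P. Serre, *Local Fields*, GTM 67 (1979): Ch. III §3 Prop. 7, §6 Prop. 12–13; Ch. V §3 Cor. 3.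
-/

set_option autoImplicit false

noncomputable section

namespace Summit.HodgeConjecture.HodgeConjecture.Cruxes.H413.F0P3cDyRamAxisLetterOneClassRamM

open scoped Valued WithZero Matrix MatrixGroups
open WithZero
open Literature.NumberTheory.Automorphic Literature.NumberTheory.Automorphic.HermitianLattice Literature.NumberTheory.Automorphic.UnitaryLatticeTree
open Literature.NumberTheory.Automorphic.UnitaryThreeFourFrame (IsRamifiedQuadraticDatum)
open Literature.NumberTheory.Rogawski1990
open Literature.NumberTheory.LocalFields.WildQuadraticDatum (v_varpi_pow)
open Summit.HodgeConjecture.HodgeConjecture.Cruxes.H413.F0P3cDyRamFourFramePieces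
open Summit.HodgeConjecture.HodgeConjecture.Cruxes.H413.F0P3cDyRamFourFrameCensusDefs (LatticeNearTransvShell)
open Summit.HodgeConjecture.HodgeConjecture.Cruxes.H413.F0P3cDyRamStageOneBDefs (mcOfRecord)
open Summit.HodgeConjecture.HodgeConjecture.Cruxes.H413.F0P3cDyRamToricCensusDefs
open Summit.HodgeConjecture.HodgeConjecture.Cruxes.H413.F0P3cDyRamAxisLetterToolkitRamM (v_map_varpi_pow_sq v_map_le_one_iff_sq)
open Summit.HodgeConjecture.HodgeConjecture.Cruxes.H413.F0P3cDyRamAxisLetterEstimatesRamM (exists_fixed_unit_lineValueSet_axis_eq_smul_xPlus_ramM)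
open Summit.HodgeConjecture.HodgeConjecture.Cruxes.H413.F0P3cDyRamAxisLetterOneClass (isOrd_tokens_of_shell valueSet_axis_eq_lineValueSet)

variable {E M : Type} [Field E] [Valued E ℤᵐ⁰] [Field M] [Valued M ℤᵐ⁰] {σ : E →+* E} {ϖ : E} {d t : ℕ} {ρ Θ : M →+* M} {α ϖM : M} {dρ tρ : ℕ}

/-- **HEAD — (AX-sh-C) «THE `hdich` OF (AX-0) HOLDS AT EVERY AXIS LEVEL», LANE C (RamM)** (★ p862003 ∕ ★ p862391 binder, byte shape, at `(ℓ, mc, a) = (d % 2, mcOfRecord d, 0)`).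
Frame: ★ p862003's block-frame binders (the sheet datum `hD` on `E`, `H₂`, `|hW| ≤ 1`, the line model `jE ρ Θ α φ lam h` with `hφs hφi hφγ hform` and the ★ DEFS letters, `Γ = ι(γ₂, u)`),
the lane-C letters (`|jE a| = |a|²`, `IsRamifiedQuadraticDatum ρ ϖM dρ tρ`, `α − ρα = ϖM − ρϖM`, `dρ = 2r`, `Θ h = h`, `Θ lam·lam = 1`), and the two DEEP letters of the V-shrink
`hw′ : |lam − 1| ≤ |jE ϖ^N|`, `hum′ : |u₀₀ − 1| ≤ |ϖ^N|` with `mstarOfRecord d + r + 1 ≤ N`.  THEN for every level `j` and every `g₂` with `φ(latt g₂) ∈ levelSet ρ Θ α (jE ϖ) h j 0`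
whose axis vertex `latt ι(g₂, 1)` lies on the shell `(d % 2, mcOfRecord d)` of `Γ − 1`, there is a `σ`-FIXED UNIT `e` with
`VS_{m*}(latt ι(g₂, 1)) = valueSetMod σ ϖ (mstarOfRecord d) (e • xPlus σ ϖ d)` — ★ p862589 §1–§2 (lane-free dictionary) ∘ ★ 2∕3 (the `κ` of the cell from `Y = κ·ϖE^j(α − ρα)`,
`|Y| = 1`, `Y ∈ 𝒪_j`). [cite: Rogawski1990, §4.9 Prop. 4.9.1 (b) p. 55] [cite: Jacobowitz1962, §4] [cite: Kottwitz1986BaseChangeUnits, §1 pp. 240–241] [cite: Serre1979, Ch. III §3 Prop. 7, Ch. V §3 Cor. 3] -/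
theorem exists_fixed_unit_valueSet_axis_eq_smul_xPlus_ramM (hD : IsRamifiedQuadraticDatum σ ϖ d t)
    (H₂ : Matrix (Fin 2) (Fin 2) E) {hW : E} (hhW : Valued.v hW ≤ 1) (jE : E →+* M) (hjsq : ∀ a, Valued.v (jE a) = Valued.v a ^ 2)
    (hρρ : ∀ x, ρ (ρ x) = x) (hvρ : ∀ x, Valued.v (ρ x) = Valued.v x) (hα1 : Valued.v α ≤ 1)
    (hDρ : IsRamifiedQuadraticDatum ρ ϖM dρ tρ) (hαρ : α - ρ α = ϖM - ρ ϖM) {r : ℕ} (hr : dρ = 2 * r)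
    (hint : ∀ z : M, Valued.v z ≤ 1 → Valued.v ((z - ρ z) / (α - ρ α)) ≤ 1)
    (hΘΘ : ∀ x, Θ (Θ x) = x) (hΘρ : ∀ x, Θ (ρ x) = ρ (Θ x)) (hvΘ : ∀ x, Valued.v (Θ x) = Valued.v x)
    (hjfix : ∀ z, ρ z = z ↔ ∃ c, jE c = z) (hΘj : ∀ x, Θ (jE x) = jE (σ x))
    (φ : (Fin 2 → E) →+ M) (hφs : ∀ (c : E) (x : Fin 2 → E), φ (c • x) = jE c * φ x) (hφi : Function.Injective φ)
    {γ₂ : GL (Fin 2) E} {lam h : M} (hφγ : ∀ x, φ ((γ₂ : Matrix (Fin 2) (Fin 2) E).mulVec x) = lam * φ x) (hlam : Θ lam * lam = 1)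
    (hh : h ≠ 0) (hΘh : Θ h = h) (hform : ∀ x y, jE (pairing σ H₂ x y) = h * Θ (φ x) * φ y + ρ (h * Θ (φ x) * φ y))
    (u : GL (Fin 1) E) {N : ℕ} (hN : mstarOfRecord d + r + 1 ≤ N)
    (hw' : Valued.v (lam - 1) ≤ Valued.v (jE ϖ ^ N)) (hum' : Valued.v (((u : Matrix (Fin 1) (Fin 1) E) 0 0) - 1) ≤ Valued.v (ϖ ^ N))
    (j : ℕ) {g₂ : GL (Fin 2) E} (hmem : (latt (g₂ : Matrix (Fin 2) (Fin 2) E)).toAddSubgroup.map φ ∈ levelSet ρ Θ α (jE ϖ) h j 0)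
    (hsh : LatticeNearTransvShell ϖ (d % 2) (mcOfRecord d) ((((endoGL (γ₂, u) : GL (Fin 3) E) : Matrix (Fin 3) (Fin 3) E) - 1))
      (latt ((endoGL (g₂, (1 : GL (Fin 1) E)) : GL (Fin 3) E) : Matrix (Fin 3) (Fin 3) E))) :
    ∃ e : E, σ e = e ∧ Valued.v e = 1 ∧
      {z : E | ∃ y ∈ latt ((endoGL (g₂, (1 : GL (Fin 1) E)) : GL (Fin 3) E) : Matrix (Fin 3) (Fin 3) E),
          Valued.v ((ϖ ^ (mstarOfRecord d))⁻¹ * (z - pairing σ (!![H₂ 0 0, 0, H₂ 0 1; 0, hW, 0; H₂ 1 0, 0, H₂ 1 1] : Matrix (Fin 3) (Fin 3) E) y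
            (((((endoGL (γ₂, u) : GL (Fin 3) E) : Matrix (Fin 3) (Fin 3) E) - 1)) *ᵥ y))) ≤ 1} =
        valueSetMod σ ϖ (mstarOfRecord d) (e • xPlus σ ϖ d) := by
  have hvσ : ∀ a, Valued.v (σ a) = Valued.v a := hD.2.1
  have hϖ : Valued.v ϖ = exp (-1 : ℤ) := hD.2.2.1
  have h1d : 1 ≤ d := hD.2.2.2.2.2.1
  have hjv : ∀ c, Valued.v (jE c) ≤ 1 ↔ Valued.v c ≤ 1 := v_map_le_one_iff_sq jE hjsq
  have hϖM : Valued.v ϖM = exp (-1 : ℤ) := hDρ.2.2.1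
  have hvαρ : Valued.v (α - ρ α) = exp (-(dρ : ℤ)) := by rw [hαρ, hDρ.2.2.2.2.1, v_varpi_pow hϖM]
  have hα : ρ α ≠ α := fun h0 => by rw [h0, sub_self, map_zero] at hvαρ; exact exp_ne_zero hvαρ.symm
  -- `hum` at the precision of record from the deep letter
  have hm : mstarOfRecord d = d % 2 + 2 * d - 1 := rfl
  have hum : Valued.v (((u : Matrix (Fin 1) (Fin 1) E) 0 0) - 1) ≤ Valued.v (ϖ ^ mstarOfRecord d) := by
    refine hum'.trans ?_
    rw [map_pow, map_pow, v_varpi_pow hϖ, v_varpi_pow hϖ, exp_le_exp]; omega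
  -- the cell presentation: `Λ = x₀·𝒪_j`, `Y = κ·ϖE^j(α − ρα)` a unit of `𝒪_j`
  obtain ⟨x₀, hx₀, hΛx, hYO, -, hYv⟩ := (mem_levelSet_iff ρ Θ α (jE ϖ) h j 0 _).1 hmem
  set κ : M := h * (x₀ * Θ x₀) with hκdef
  have hY : dualGen ρ Θ α (jE ϖ ^ j) h x₀ = κ * (jE ϖ ^ j * (α - ρ α)) := by rw [dualGen_def]
  have hcc := v_map_varpi_pow_sq hϖ jE hjsq j
  have hΘκ : Θ κ = κ := by rw [hκdef, map_mul, map_mul, hΘh, hΘΘ]; ring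
  clear_value κ
  have hκY : Valued.v κ * Valued.v (jE ϖ ^ j) * Valued.v (α - ρ α) = 1 := by
    rw [← Valuation.map_mul, ← Valuation.map_mul, mul_assoc, ← hY, hYv, pow_zero]
  have hκρ : Valued.v (κ + ρ κ) ≤ 1 := by
    have hρϖ : ρ (jE ϖ) = jE ϖ := (hjfix _).2 ⟨ϖ, rfl⟩
    have hne : Valued.v (jE ϖ ^ j * (α - ρ α)) ≠ 0 := by rw [map_mul, hvαρ, hcc, ← exp_add]; exact exp_ne_zero
    have h2 := ((isOrd_iff _ _ _ _).1 hYO).2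
    have e : dualGen ρ Θ α (jE ϖ ^ j) h x₀ - ρ (dualGen ρ Θ α (jE ϖ ^ j) h x₀) = (κ + ρ κ) * (jE ϖ ^ j * (α - ρ α)) := by
      rw [hY]; simp only [map_mul, map_sub, map_pow, hρϖ, hρρ]; ring
    rw [e, Valuation.map_mul _ (κ + ρ κ), ← le_div_iff₀ (zero_lt_iff.2 hne), div_self hne] at h2
    exact h2
  -- the shell as order tokens, and the letter in the line model (★ p862589, lane-free)
  obtain ⟨hlev, hnlev, hsq⟩ := isOrd_tokens_of_shell hϖ h1d hvρ jE φ hφs hφi hφγ u hum hx₀ hΛx hsh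
  rw [valueSet_axis_eq_lineValueSet hvσ hϖ H₂ hhW jE hjv hρρ hvρ hα hα1 hint hΘΘ hΘρ hvΘ hjfix φ hφs hφγ hh hform u (mstarOfRecord d) hum j 0 hmem hΛx]
  -- the nine inequalities at the letters of record, `k′ = m′ = N`, `2n′ = 2⌊(N + d)∕2⌋`
  have hmc : mcOfRecord d = 2 * ((mstarOfRecord d + d) / 2) := rfl
  rw [hmc] at hsq
  rw [← hκdef]
  exact exists_fixed_unit_lineValueSet_axis_eq_smul_xPlus_ramM hD jE hjsq hjfix hΘj hρρ hvρ hΘΘ hΘρ hvΘ hα1 hDρ hαρ hr hΘκ hκρ hκY hlam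
    (n' := (N + d) / 2) hw' hum' hlev hnlev hsq
    (by omega) (by omega) (by omega) (by omega) (by omega) (by omega) (by omega) (by omega) (by omega)

end Summit.HodgeConjecture.HodgeConjecture.Cruxes.H413.F0P3cDyRamAxisLetterOneClassRamM

end
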